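import Summits.HodgeConjecture.HodgeConjecture.Theorems.F0P3U3PrincipalSeriesOpenCellTorusChar      -- ★ N1 (T-ℓ): `torus_normalizedJacquet_openCellLine_eq_weylChar`; brings ★ closed cell, ★ `finrank_le_one_cmPrincipalSeries`
import Summits.HodgeConjecture.HodgeConjecture.Theorems.F0P3U3PrincipalSeriesJacquetClosedCell      -- ★ `closedCell_cmPrincipalSeries`
import Summits.HodgeConjecture.HodgeConjecture.Theorems.F0P3U3PrincipalSeriesJacquetFiltrationHolds  -- ★ `finrank_le_one_cmPrincipalSeries`
import Literature.NumberTheory.Automorphic.CMPrincipalSeriesJacquetEvalOne                          -- ★ `exists_cmPrincipalSeries_cmTorusCharPair_toFun_one_eq_one` (f₀ with f₀(1)=1, and `E ∘ mk = ev₁`)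
import Literature.NumberTheory.Automorphic.CMPrincipalSeriesOpenCellSection                         -- ★ `exists_cmPrincipalSeries_cmTorusCharPair_toFun_one_eq_zero_and_mk_ne_zero` (Φ with Φ(1)=0, [Φ]≠0)
import Literature.NumberTheory.Automorphic.JacquetNonzeroEmbedsNormalizedInd                        -- ★ `ParabolicTriple.rootDeltaChar_eq_one_of_isLimitOfCompactOpen`
import HarnessLib

/-!
# F0 · P3c · line LH6 «StCharTS» — «JACQUET SEMISIMPLE FROM ONE VECTOR★» (ROAD «KEYS3-ANALYTIC», LEAD T15-03; brick B6a of MEMO v3 §1): on `U(Φ₃)(L⁺_v)`, `v` non-split,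
# a `w`-FIXED character `χ = (χ₁, χ₂)` (`wχ = χ`): if ONE vector `f₀ ∈ i_G(χ)` with `f₀(1) = 1` has `r_B(m)[f₀] = χ(m)[f₀]` for all `m ∈ T`, then `T` acts on the whole Jacquet
# module `r_B i_G(χ)` by the scalar `χ` (★ N1: `T` acts on the closed-cell line by `wχ`, the quotient is at most a line), and then `i_G(χ)` carries a `(B, χδ^{1/2})`-eigenfunctional
# NOT proportional to `ev₁` — the `hSecond` binder of ★ FILE 2 `keysRedThree_of_secondEigenfunctional` [Keys1984 §7; Casselman1995 §6.3, L. 7.1.1; BernsteinZelevinsky1977 §2.3]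

Cell `pub/hodgecm-mathlib`, crux H413 = `stmt-HodgeConjecture-24833` (lane `--supports … --as helper`), route HCCMUnconditional; seat F0P2-p06 (g21), ROAD «KEYS3-ANALYTIC» (LEAD
F0P3a-plan (g16) T15-03 «GO»; MEMO `F0/P2/F0P2-p06/g21/MEMO-KEYS3-analytic-road.v3` §1, §4 B6).  THEOREMS ONLY (0 def ∕ 0 instance ∕ 0 notation ∕ 0 sorry); ★-only imports.  This is the
ALGEBRAIC end of the road: the remaining input «`r_B(m)[f₀] = χ(m)[f₀]` for all `m`» is what ★ T3 `JacquetSplitTest` turns into «`Λ(g₀(m)) = 0`» and ★ B5∕B3∕B4 evaluate (B6b).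
* §1 `coinvariants_mk_borel_apply` — `[I(p) f] = δ^{1/2}(p) · r_B(proj p)[f]` (`p = proj(p)·n`, ★ `proj_inv_mul_mem`, Mathlib `Coinvariants.mk_self_apply`, ★ `normalizedJacquet_mk`).
* §2 (generic linear algebra, the ★ packages as hypotheses — as in ★ `n1_line_data`) **`apply_eq_smul_of_one_vector`** — `(J m − χ m)C ⊆ ℓ`, `dim C∕ℓ ≤ 1`, `J m|_ℓ = χ m`, one vector
  `f₀` with `ev f₀ = 1`, `J m [f₀] = χ m [f₀]` ⇒ `J m = χ m · id`; **`exists_functional_comp_not_proportional`** — a `φ` on `C` not proportional to `ev` through `mk` (duals separate `[Φ] ≠ 0`).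
* §3 **`secondEigenfunctional_of_one_vector`** — `U(Φ₃)(L⁺_v)`, `v` non-split, `wχ = χ`, one vector ⇒ the `hSecond` text of ★ FILE 2, binder for binder.
HONEST LABEL: HC_CM is proved only modulo the 7 printed citations (2 remaining named inputs: hLiu418 = `stmt-HodgeConjecture-24832`, h413 = `stmt-HodgeConjecture-24833`) until rung 0
closes; count-neutral (the named input `hKeysRed3` is discharged only when B6b docks B3∕B4∕B5 on §2's one-vector hypothesis).

## References
* [Keys1984] D. Keys, Compositio Math. 51 (1984), §3, §7 Thm. (1).
* [Casselman1995] W. Casselman, *Introduction to the theory of admissible representations of p-adic reductive groups* (1995), §3.2, §6.3, Lemma 7.1.1 (a).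
* [BernsteinZelevinsky1977] I. N. Bernstein, A. V. Zelevinsky, Ann. Sci. ÉNS 10 (1977), §1.8, §2.3, Geometrical Lemma 2.12.
* [Rogawski1990] J. D. Rogawski, Ann. of Math. Stud. 123 (1990), §12.1 p. 171, §12.2 (3) pp. 173–174.
-/

set_option autoImplicit false
-- the mandated namespace has the single-problem summit's repeated segment (`HodgeConjecture.HodgeConjecture`)
set_option linter.dupNamespace false

noncomputable section

open NumberField IsDedekindDomain
open scoped Matrix
open Literature.NumberTheory.Rogawski1990 Literature.NumberTheory.Automorphic Literature.NumberTheory.Automorphic.UnitaryGroup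

namespace Summit.HodgeConjecture.HodgeConjecture.Cruxes.H413.F0P3cStCharTSKeys3JacquetSemisimple

/-! ## §1 `[I(p) f] = δ^{1/2}(p) · r_B(proj p) [f]` (generic parabolic triple) -/

section Generic

variable {G V : Type*} [Group G] [TopologicalSpace G] [IsTopologicalGroup G] [AddCommGroup V] [Module ℂ V]
  (t : ParabolicTriple G) [LocallyCompactSpace ↥t.P]

/-- **`[ρ(p) v] = δ_P^{1/2}(p) · r_P(proj p) [v]`** in the Jacquet module (`p = proj(p) · n` with `n ∈ N` acting trivially on coinvariants, `δ_P^{1/2}|_N = 1`).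
[cite: BernsteinZelevinsky1977, §1.8, §2.3] -/
theorem coinvariants_mk_apply_parabolic (hN : IsLimitOfCompactOpen ↥t.N) (ρ : Representation ℂ G V) (p : ↥t.P) (v : V) :
    Representation.Coinvariants.mk (t.restrict ρ) (ρ (p : G) v) =
      ((rootDeltaChar t.P p : ℂˣ) : ℂ) • ρ.normalizedJacquet t (t.proj p) (Representation.Coinvariants.mk (t.restrict ρ) v) := by
  -- `p = m · n`, `m = proj p ∈ M`, `n = m⁻¹ p ∈ N`
  have hn : ((t.proj p : ↥t.M) : G)⁻¹ * (p : G) ∈ t.N := t.proj_inv_mul_mem p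
  set n : ↥(t.N.subgroupOf t.P) := ⟨⟨((t.proj p : ↥t.M) : G)⁻¹ * (p : G), t.N_le hn⟩, by
    rw [Subgroup.mem_subgroupOf]; exact hn⟩ with hndef
  have hp : (p : G) = ((t.proj p : ↥t.M) : G) * ((((t.proj p : ↥t.M) : G)⁻¹ * (p : G))) := by rw [mul_inv_cancel_left]
  have hmk : Representation.Coinvariants.mk (t.restrict ρ) (ρ ((((t.proj p : ↥t.M) : G)⁻¹ * (p : G))) v) =
      Representation.Coinvariants.mk (t.restrict ρ) v :=
    Representation.Coinvariants.mk_self_apply (t.restrict ρ) n v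
  rw [Representation.normalizedJacquet_mk, smul_smul]
  -- `δ^{1/2}(p) · δ^{1/2}(m)⁻¹ = 1` because `δ^{1/2}(n) = 1`
  have hδn : rootDeltaChar t.P ⟨((t.proj p : ↥t.M) : G)⁻¹ * (p : G), t.N_le hn⟩ = 1 := t.rootDeltaChar_eq_one_of_isLimitOfCompactOpen hN _ hn
  have hδ : rootDeltaChar t.P p = rootDeltaChar t.P (Subgroup.inclusion t.M_le (t.proj p)) := by
    have hfac : p = Subgroup.inclusion t.M_le (t.proj p) * ⟨((t.proj p : ↥t.M) : G)⁻¹ * (p : G), t.N_le hn⟩ :=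
      Subtype.ext (by rw [Subgroup.coe_mul, Subgroup.coe_inclusion]; exact hp)
    rw [hfac, map_mul, hδn, mul_one, ← hfac]
  rw [hδ, ← Units.val_mul, mul_inv_cancel, Units.val_one, one_smul]
  conv_lhs => rw [hp, map_mul]
  change Representation.Coinvariants.mk (t.restrict ρ) (ρ ((t.proj p : ↥t.M) : G) (ρ ((((t.proj p : ↥t.M) : G)⁻¹ * (p : G))) v)) = _
  rw [← Representation.jacquetModule_mk, ← Representation.jacquetModule_mk, hmk]

/-- **A functional on the Jacquet module on which `M` acts by the scalar `χ` lifts to a `(P, χ·δ_P^{1/2})`-eigenfunctional** `ℓ = φ ∘ [·]`: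
`ℓ (ρ p v) = χ(proj p) δ^{1/2}(p) ℓ v` (§1). [cite: BernsteinZelevinsky1977, §2.3] [cite: Casselman1995, §3.2] -/
theorem eigenfunctional_comp_mk_of_scalar (hN : IsLimitOfCompactOpen ↥t.N) (ρ : Representation ℂ G V) (χ : ↥t.M →* ℂˣ)
    (hJ : ∀ (m : ↥t.M) (x : (t.restrict ρ).Coinvariants), ρ.normalizedJacquet t m x = ((χ m : ℂˣ) : ℂ) • x)
    (φ : (t.restrict ρ).Coinvariants →ₗ[ℂ] ℂ) (p : ↥t.P) (v : V) :
    (φ ∘ₗ Representation.Coinvariants.mk (t.restrict ρ)) (ρ (p : G) v) =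
      ((χ (t.proj p) : ℂˣ) : ℂ) * ((rootDeltaChar t.P p : ℂˣ) : ℂ) * (φ ∘ₗ Representation.Coinvariants.mk (t.restrict ρ)) v := by
  rw [LinearMap.comp_apply, LinearMap.comp_apply, coinvariants_mk_apply_parabolic t hN ρ p v, hJ, map_smul, map_smul, smul_eq_mul, smul_eq_mul,
    ← mul_assoc, mul_comm ((rootDeltaChar t.P p : ℂˣ) : ℂ)]

end Generic

/-! ## §2 Generic linear algebra (plain functions, hypotheses in the shape of the ★ packages — as ★ `n1_line_data` does) -/

section Linear

variable {C S M : Type*} [AddCommGroup C] [Module ℂ C]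

/-- **Scalar action from ONE vector.**  `HC` = ★ `closedCell_cmPrincipalSeries`, `HU` = ★ `finrank_le_one_cmPrincipalSeries`, `HT` = ★ N1 (T-ℓ) `torus_normalizedJacquet_openCellLine_eq_weylChar`,
`HE` = the `E ∘ mk = ev` half of ★ `exists_cmPrincipalSeries_cmTorusCharPair_toFun_one_eq_one`, `hw : wχ = χ`; if `J m [f₀] = χ m [f₀]` for one `f₀` with `ev f₀ = 1`, then `J m = χ m · id`.
[cite: Casselman1995, Lemma 7.1.1 (a)] [cite: BernsteinZelevinsky1977, Geometrical Lemma 2.12] -/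
theorem apply_eq_smul_of_one_vector (mk : S → C) (ev : S → ℂ) (J : M → C → C) (χc wχc : M → ℂ)
    (hJadd : ∀ m x y, J m (x + y) = J m x + J m y) (hJsmul : ∀ (m) (c : ℂ) x, J m (c • x) = c • J m x)
    (HC : ∃ ℓ : Submodule ℂ C, (∀ m, ∀ x ∈ ℓ, J m x ∈ ℓ) ∧ (∀ m x, J m x - χc m • x ∈ ℓ) ∧
      FiniteDimensional ℂ (C ⧸ ℓ) ∧ Module.finrank ℂ (C ⧸ ℓ) ≤ 1 ∧ (∀ x, x ∈ ℓ ↔ ∃ f, ev f = 0 ∧ mk f = x))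
    (HU : ∀ ℓ : Submodule ℂ C, (∀ x, x ∈ ℓ ↔ ∃ f, ev f = 0 ∧ mk f = x) → FiniteDimensional ℂ ↥ℓ ∧ Module.finrank ℂ ↥ℓ ≤ 1)
    (HT : ∀ ℓ : Submodule ℂ C, (∀ x ∈ ℓ, ∃ f, ev f = 0 ∧ mk f = x) → (∀ f, ev f = 0 → mk f ∈ ℓ) →
      FiniteDimensional ℂ ↥ℓ → Module.finrank ℂ ↥ℓ ≤ 1 → ∀ m, ∀ x ∈ ℓ, J m x = wχc m • x)
    (hw : ∀ m, wχc m = χc m)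
    (HE : ∃ E : C →ₗ[ℂ] ℂ, (∀ f, E (mk f) = ev f) ∧ E ≠ 0)
    (f₀ : S) (hf₀ : ev f₀ = 1) (hJf₀ : ∀ m, J m (mk f₀) = χc m • mk f₀) (m : M) (x : C) :
    J m x = χc m • x := by
  obtain ⟨ℓ, -, -, hfdq, hrkq, hℓ⟩ := HC
  obtain ⟨hfdℓ, hrkℓ⟩ := HU ℓ hℓ
  have hline : ∀ y ∈ ℓ, J m y = χc m • y := fun y hy => by
    rw [← hw]; exact HT ℓ (fun z hz => (hℓ z).1 hz) (fun f hf => (hℓ _).2 ⟨f, hf, rfl⟩) hfdℓ hrkℓ m y hy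
  obtain ⟨E, hE, -⟩ := HE
  have hEℓ : ∀ y ∈ ℓ, E y = 0 := by
    intro y hy
    obtain ⟨f, hf1, rfl⟩ := (hℓ y).1 hy
    rw [hE, hf1]
  have hx₀ℓ : mk f₀ ∉ ℓ := by
    intro h
    have h1 := hEℓ _ h
    rw [hE, hf₀] at h1
    exact one_ne_zero h1
  haveI := hfdq
  have hq0 : ℓ.mkQ (mk f₀) ≠ 0 := by
    rw [Ne, Submodule.mkQ_apply, Submodule.Quotient.mk_eq_zero]; exact hx₀ℓ
  have hrk1 : Module.finrank ℂ (C ⧸ ℓ) = 1 := le_antisymm hrkq (Module.finrank_pos_iff_exists_ne_zero.2 ⟨_, hq0⟩)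
  obtain ⟨c, hc⟩ := (finrank_eq_one_iff_of_nonzero' _ hq0).1 hrk1 (ℓ.mkQ x)
  have hy : x - c • mk f₀ ∈ ℓ := by
    rw [← Submodule.Quotient.mk_eq_zero, ← Submodule.mkQ_apply, map_sub, map_smul, ← hc, sub_self]
  have hxdec : c • mk f₀ + (x - c • mk f₀) = x := add_sub_cancel _ _
  calc J m x = J m (c • mk f₀ + (x - c • mk f₀)) := by rw [hxdec]
    _ = c • J m (mk f₀) + J m (x - c • mk f₀) := by rw [hJadd, hJsmul]
    _ = c • (χc m • mk f₀) + χc m • (x - c • mk f₀) := by rw [hJf₀ m, hline _ hy]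
    _ = χc m • x := by rw [smul_comm, ← smul_add, hxdec]

/-- **A functional on `C` not proportional to `ev` through `mk`**: if some `Φ` has `ev Φ = 0` but `mk Φ ≠ 0` (★ open-cell section), any `φ ∈ C^*` with `φ (mk Φ) ≠ 0` (duals separate points,
Mathlib `Module.Projective.exists_dual_ne_zero`) satisfies `φ (mk Φ) ≠ c · ev Φ = 0` for every `c`. [cite: Keys1984, §3] [cite: BernsteinZelevinsky1977, §2.3] -/
theorem exists_functional_comp_not_proportional (mk : S → C) (ev : S → ℂ) (HD : ∃ Φ, ev Φ = 0 ∧ mk Φ ≠ 0) :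
    ∃ φ : C →ₗ[ℂ] ℂ, ∀ c : ℂ, ∃ f, φ (mk f) ≠ c * ev f := by
  obtain ⟨Φ, hΦ1, hΦne⟩ := HD
  obtain ⟨φ, hφ⟩ := Module.Projective.exists_dual_ne_zero ℂ hΦne
  exact ⟨φ, fun c => ⟨Φ, by rw [hΦ1, mul_zero]; exact hφ⟩⟩

end Linear

/-! ## §3 `U(Φ₃)(L⁺_v)`, `v` non-split, `wχ = χ`: the second eigenfunctional from ONE vector -/

section CM

variable (L : Type) [Field L] [NumberField L] [IsCMField L] (v : HeightOneSpectrum (𝓞 ↥(maximalRealSubfield L)))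
  (hns : ∀ w : PlacesOver L v, IsCMField.complexConj L • w.1 = w.1)

include hns in
set_option synthInstance.maxHeartbeats 400000 in
set_option maxHeartbeats 8000000 in
-- statement∕proof-heavy: the `SmoothInd` carrier of `cmPrincipalSeries` (class of ★ N1 ∕ ★ FILE 2); the ★ packages are passed WHOLE to §2 (as in ★ `n1_line_data`)
/-- **«THE SECOND EIGENFUNCTIONAL FROM ONE VECTOR».**  `v` non-split, `χ₁, χ₂` continuous with `wχ = χ` (`cmWeylTorusCharPair = cmTorusCharPair`; e.g. `χ₁|_{F_v^×} = 1`, ★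
`cmWeylTorusCharPair_eq_of_apply_fixed_eq_one`); if some section `f₀` with `f₀(1) = 1` has `r_B(m)[f₀] = χ(m)[f₀]` for every `m ∈ T`, then `r_B = χ·id` on the Jacquet module (★ closed cell,
★ `finrank_le_one_cmPrincipalSeries`, ★ N1 (T-ℓ) `torus_normalizedJacquet_openCellLine_eq_weylChar`, §2) and `i_G(χ₁, χ₂)` carries a `(B, χδ_B^{1/2})`-eigenfunctional `ℓ` with
`∀ c, ∃ f, ℓ f ≠ c · f(1)` — the `hSecond` binder of ★ FILE 2 `keysRedThree_of_secondEigenfunctional`, VERBATIM (`ℓ = φ ∘ [·]`, §1 for the eigen-property, §2 for `φ`).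
[cite: Keys1984, §3; §7 Thm. (1)] [cite: Casselman1995, Lemma 7.1.1 (a), §6.3] [cite: BernsteinZelevinsky1977, §2.3, Geometrical Lemma 2.12] [cite: Rogawski1990, §12.2 (3) pp. 173–174] -/
theorem secondEigenfunctional_of_one_vector
    (χ₁ : (LocalRing L v)ˣ →* ℂˣ) (χ₂ : ↥(normOneUnits (conjLocal L (IsCMField.complexConj L) v)) →* ℂˣ)
    (h₁ : Continuous fun x => ((χ₁ x : ℂˣ) : ℂ)) (h₂ : Continuous fun x => ((χ₂ x : ℂˣ) : ℂ))
    (hw : cmWeylTorusCharPair L v χ₁ χ₂ = cmTorusCharPair L v χ₁ χ₂)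
    (f₀ : haveI := locallyCompactSpace_cmBorelU L 3 v
      Representation.SmoothInd (cmBorelTriple L 3 v).P
        (Representation.twist (((Representation.trivial ℂ ↥(torusU (conjLocal L (IsCMField.complexConj L) v) (cmLocalForm L 3 v)) ℂ).twist
          (cmTorusCharPair L v χ₁ χ₂)).comp (cmBorelTriple L 3 v).proj) (rootDeltaChar (cmBorelTriple L 3 v).P)))
    (hf₀ : f₀.toFun 1 = 1)
    (hJf₀ : haveI := locallyCompactSpace_cmBorelU L 3 v
      ∀ m : ↥(cmBorelTriple L 3 v).M,
        (cmPrincipalSeries L 3 v (cmTorusCharPair L v χ₁ χ₂)).normalizedJacquet (cmBorelTriple L 3 v) m (Representation.Coinvariants.mk ((cmBorelTriple L 3 v).restrict (cmPrincipalSeries L 3 v (cmTorusCharPair L v χ₁ χ₂))) f₀) =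
          ((cmTorusCharPair L v χ₁ χ₂ m : ℂˣ) : ℂ) • Representation.Coinvariants.mk ((cmBorelTriple L 3 v).restrict (cmPrincipalSeries L 3 v (cmTorusCharPair L v χ₁ χ₂))) f₀) :
    haveI := locallyCompactSpace_cmBorelU L 3 v
    ∃ ℓ : Representation.SmoothInd (cmBorelTriple L 3 v).P
        (Representation.twist (((Representation.trivial ℂ ↥(torusU (conjLocal L (IsCMField.complexConj L) v) (cmLocalForm L 3 v)) ℂ).twist
          (cmTorusCharPair L v χ₁ χ₂)).comp (cmBorelTriple L 3 v).proj) (rootDeltaChar (cmBorelTriple L 3 v).P)) →ₗ[ℂ] ℂ,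
      (∀ (p : ↥(cmBorelTriple L 3 v).P) (f : _),
        ℓ (cmPrincipalSeries L 3 v (cmTorusCharPair L v χ₁ χ₂) p.1 f) =
          ((cmTorusCharPair L v χ₁ χ₂ ((cmBorelTriple L 3 v).proj p) : ℂˣ) : ℂ) * ((rootDeltaChar (cmBorelTriple L 3 v).P p : ℂˣ) : ℂ) * ℓ f) ∧
      ∀ c : ℂ, ∃ f, ℓ f ≠ c * f.toFun 1 := by
  haveI := locallyCompactSpace_cmBorelU L 3 v
  -- the ★ packages, whole
  have HC := F0P3U3PrincipalSeriesJacquetClosedCell.closedCell_cmPrincipalSeries L v (cmTorusCharPair L v χ₁ χ₂)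
  have HU := F0P3U3PrincipalSeriesJacquetFiltrationHolds.finrank_le_one_cmPrincipalSeries L v hns (cmTorusCharPair L v χ₁ χ₂)
  have HT := F0P3U3PrincipalSeriesOpenCellTorusChar.torus_normalizedJacquet_openCellLine_eq_weylChar L v hns χ₁ χ₂ h₁ h₂
  have HLE := exists_cmPrincipalSeries_cmTorusCharPair_toFun_one_eq_one L v χ₁ χ₂ h₁ h₂
  have HD := exists_cmPrincipalSeries_cmTorusCharPair_toFun_one_eq_zero_and_mk_ne_zero L v χ₁ χ₂ h₁ h₂
  -- `r_B = χ · id` (§2 over the packages)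
  have hscalar : ∀ (m : ↥(cmBorelTriple L 3 v).M) (x : ((cmBorelTriple L 3 v).restrict (cmPrincipalSeries L 3 v (cmTorusCharPair L v χ₁ χ₂))).Coinvariants),
      (cmPrincipalSeries L 3 v (cmTorusCharPair L v χ₁ χ₂)).normalizedJacquet (cmBorelTriple L 3 v) m x = ((cmTorusCharPair L v χ₁ χ₂ m : ℂˣ) : ℂ) • x :=
    apply_eq_smul_of_one_vector
      (mk := ⇑(Representation.Coinvariants.mk ((cmBorelTriple L 3 v).restrict (cmPrincipalSeries L 3 v (cmTorusCharPair L v χ₁ χ₂)))))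
      (ev := fun f => f.toFun 1)
      (J := fun m => ⇑((cmPrincipalSeries L 3 v (cmTorusCharPair L v χ₁ χ₂)).normalizedJacquet (cmBorelTriple L 3 v) m))
      (χc := fun m => ((cmTorusCharPair L v χ₁ χ₂ m : ℂˣ) : ℂ))
      (wχc := fun m => ((cmWeylTorusCharPair L v χ₁ χ₂ m : ℂˣ) : ℂ))
      (fun m x y => map_add _ x y) (fun m c x => map_smul _ c x)
      HC HU HT (fun m => by rw [hw]) HLE.2 f₀ hf₀ hJf₀
  -- the functional `φ` (§2) and `ℓ := φ ∘ [·]`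
  obtain ⟨φ, hφ⟩ := exists_functional_comp_not_proportional (mk := ⇑(Representation.Coinvariants.mk ((cmBorelTriple L 3 v).restrict (cmPrincipalSeries L 3 v (cmTorusCharPair L v χ₁ χ₂))))) (ev := fun f => f.toFun 1) HD
  refine ⟨φ ∘ₗ Representation.Coinvariants.mk ((cmBorelTriple L 3 v).restrict (cmPrincipalSeries L 3 v (cmTorusCharPair L v χ₁ χ₂))),
    fun p f => eigenfunctional_comp_mk_of_scalar (cmBorelTriple L 3 v) (isLimitOfCompactOpen_cmBorelTriple_N L 3 v)
      (cmPrincipalSeries L 3 v (cmTorusCharPair L v χ₁ χ₂)) (cmTorusCharPair L v χ₁ χ₂) hscalar φ p f, fun c => ?_⟩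
  obtain ⟨f, hf⟩ := hφ c
  exact ⟨f, hf⟩

end CM

end Summit.HodgeConjecture.HodgeConjecture.Cruxes.H413.F0P3cStCharTSKeys3JacquetSemisimple

end
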